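import Mathlib.Analysis.Calculus.SmoothSeries
import Mathlib.Analysis.Calculus.FDeriv.Mul
import Literature.Analysis.Calculus.ExpDifferentialGSeries

/-!
# The differential of the exponential map as a power series in `ad` (Varadarajan, Thm. 2.14.3)

Topic `Analysis/Calculus`; namespace `Literature.Analysis.Calculus.ExpDifferential` (the grouping sub-namespace
names the object: the differential `D exp` of the exponential map of a Banach algebra).

Let `𝔸` be a Banach algebra over `𝕂 = ℝ` or `ℂ`, `exp : 𝔸 → 𝔸` its exponential (`NormedSpace.exp`), and for
`X ∈ 𝔸` let `ad X : 𝔸 →L[𝕂] 𝔸`, `ad X (Y) = XY − YX`.  This file PROVES the classical formula for the Fréchet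
derivative of `exp` at an arbitrary point of a (non-commutative) Banach algebra in its POWER-SERIES form

  `D exp_X (h) = exp X · g(ad X)(h)`,  `g(z) = Σ_{n ≥ 0} (−1)ⁿ zⁿ/(n+1)! = (1 − e^{−z})/z`,

i.e. along a differentiable curve `A(t)`

  `e^{−A(t)} (d/dt) e^{A(t)} = Σ_{n ≥ 0} ((−1)ⁿ/(n+1)!) (ad_{A(t)})ⁿ A′(t) = g(ad_{A(t)}) A′(t)`

— V. S. Varadarajan, *Lie groups, Lie algebras, and their representations*, Theorem 2.14.3 [Varadarajan1984]
(for Lie groups); B. C. Hall, *Lie Groups, Lie Algebras, and Representations*, 2nd ed., Theorem 5.4,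
(5.10)–(5.11) [Hall2015] (matrices: «d/dt e^{X(t)} = e^{X(t)}{(I − e^{−ad_{X(t)}})/ad_{X(t)}}(dX/dt)»,
«(1 − e^{−z})/z = Σ_{k=0}^∞ (−1)^k z^k/(k+1)!»); and, verbatim in the form typed here, T. Bałaban,
*Averaging operations for lattice gauge theories*, CMP 98 (1985), (32)–(33) p. 22 [Balaban1985Averaging]
(«Let us start with the following basic formula (see [7, Theorem 2.14.3])», [7] = Varadarajan).

Main declarations (all PROVED, `sorry`-free, Mathlib only):

* `mulL 𝕂 X`, `mulR 𝕂 X`, `ad 𝕂 X : 𝔸 →L[𝕂] 𝔸` — left/right multiplication and `ad X = mulL X − mulR X` (private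
  helpers: they commute, `exp (mulL X) = mulL (exp X)`, `exp (mulR X) = mulR (exp X)`);
  `exp_ad_apply` («`Ad(e^X) = e^{ad X}`»: `exp (ad X) h = e^X h e^{−X}`, Hall Prop. 3.35);
* (from the companion `ExpDifferentialGSeries`: `gSer 𝕂 T = Σ_{n≥0} (−T)ⁿ/(n+1)!` = the entire function `g` of (33)
  on a Banach algebra, `mul_gSer : T g(T) = 1 − e^{−T}`, `exp_mul_gSer : e^{T} g(T) = g(−T)`, `symSum l r N =
  Σ_{k<N} l^k r^{N−1−k}` and `hasSum_inv_factorial_smul_symSum : Σ_N (1/N!) symSum l r N = exp l · g(l − r)` for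
  commuting `l, r`, and the invertibility of `g(T)` for `‖T‖ ≤ 1` ((34)));
* `dexp 𝕂 X = Σ_N (1/N!) symSum (mulL X) (mulR X)` (so `dexp X h = Σ_N (1/N!) Σ_{k<N} X^k h X^{N−1−k}`),
  `hasFDerivAt_exp_dexp : HasFDerivAt exp (dexp 𝕂 X) X` (term-by-term differentiation of `Σ Xᴺ/N!`),
  `dexp_eq : dexp 𝕂 X = mulL (exp X) · g(ad X)`, `dexp_apply : dexp X h = exp X · g(ad X) h`, and
  `fderiv_exp_apply : fderiv 𝕂 exp X h = exp X · g(ad X) h` — **Theorem 2.14.3 / Theorem 5.4 (5.10)**;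
* **(32)/(5.11) along a curve**: `hasDerivAt_exp_comp_gSer` (`(e^{A})′(t) = e^{A(t)} g(ad_{A(t)}) A′(t)`) and
  `exp_neg_mul_deriv_exp_comp` (`e^{−A(t)} (e^{A})′(t) = g(ad_{A(t)}) A′(t)`);
* `norm_ad_le : ‖ad X‖ ≤ 2‖X‖`; `gSer_apply_eq_tsum : g(T) h = Σ_n ((−1)ⁿ/(n+1)!) Tⁿ h` (the operator calculus
  «`f(ad_X) Y = Σ fₙ (ad_X)ⁿ Y`» of p. 22 for `f = g`);
* `exp_ad_mul_gSer_ad : e^{ad X} g(ad X) = g(ad(−X))` — the identity that turns `D exp_Y(∂Z) = X e^Y`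
  ([Balaban1985Averaging] (36)–(37), tree: `…B7Eq38Remainder.fderiv_exp_deriv_Z28`) into `∂Z = g⁻¹(−ad_Y) X`.

Proof route.  Hall's book proves Theorem 5.4 by Tuynman's Riemann-sum argument and Varadarajan by Lie theory; the
tree's sibling `Literature.Analysis.Calculus.ExpDuhamel` (`fderiv_exp_apply_eq_exp_mul_integral`) has the INTEGRAL
form `D exp_X(h) = e^X ∫₀¹ e^{−rX} h e^{rX} dr` (Hall (5.13)), but not the series `(1 − e^{−ad X})/ad X`.  Here we
give a direct power-series proof using the commuting left and right multiplications `L_X`, `R_X` (a deviation from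
both printed proofs, chosen because it needs neither integration nor Lie theory): (i) `x ↦ xᴺ` has derivative
`h ↦ Σ_{k<N} X^k h X^{N−1−k}` (`HasFDerivAt.mul'`, induction), and
`exp = Σ xᴺ/N!` is differentiated term by term on a ball (`hasFDerivAt_tsum_of_isPreconnected`); (ii) with
`l = mulL X`, `r = mulR X` (commuting elements of the Banach algebra `𝔸 →L[𝕂] 𝔸`, `ad X = l − r`) the degree-`N`
identity `symSum_eq_sum_choose` (induction on `N`: both sides satisfy `S_{N+1} = r^N + l·S_N`, by Pascal's rule and
the binomial theorem for the commuting pair `l`, `b = r − l`) and the Cauchy product give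
`Σ_N symSum/N! = exp(l) · g(l − r)` (companion file); (iii) `exp (mulL X) = mulL (exp X)`.  Nothing here is
specific to matrices; no Baker–Campbell–Hausdorff
theory is used.  Mathlib has the derivative of `exp` at `0` (`hasFDerivAt_exp_zero`), along one-parameter
subgroups (`hasDerivAt_exp_smul_const`) and in commutative algebras (`hasFDerivAt_exp`) only
(`lean search 'fderiv_exp|Duhamel|dexp'`).

## References

* [Varadarajan1984] V. S. Varadarajan, *Lie Groups, Lie Algebras, and Their Representations*, GTM 102 (1984;
  1st ed. Prentice-Hall 1974), Theorem 2.14.3.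
* [Hall2015] B. C. Hall, *Lie Groups, Lie Algebras, and Representations*, 2nd ed., GTM 222 (2015), §5.4,
  Theorem 5.4, (5.10)–(5.13); Proposition 3.35.
* [Balaban1985Averaging] T. Bałaban, CMP **98** (1985) 17–51, (32)–(34) pp. 22–23.
-/


noncomputable section

open NormedSpace Filter Finset
open scoped Topology Nat

namespace Literature.Analysis.Calculus.ExpDifferential

/-! ### §1. Left and right multiplications, `ad`, and `Ad(e^X) = e^{ad X}` -/

section Algebra

variable (𝕂 : Type*) [RCLike 𝕂] {𝔸 : Type*} [NormedRing 𝔸] [NormedAlgebra 𝕂 𝔸]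

/-- Left multiplication `L_X : h ↦ X h` as an element of the Banach algebra `𝔸 →L[𝕂] 𝔸`. [folklore] -/
def mulL (X : 𝔸) : 𝔸 →L[𝕂] 𝔸 := ContinuousLinearMap.mul 𝕂 𝔸 X

/-- Right multiplication `R_X : h ↦ h X`. [folklore] -/
def mulR (X : 𝔸) : 𝔸 →L[𝕂] 𝔸 := (ContinuousLinearMap.mul 𝕂 𝔸).flip X

/-- `ad X = L_X − R_X : h ↦ X h − h X` («where `ad_X Y = [X, Y] = XY − YX`», p. 22; «We will treat the expression
`ad_X Y` for a fixed `X` as a linear operator on a space of matrices `Y`»). [cite: Balaban1985Averaging, (29) p.22] -/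
def ad (X : 𝔸) : 𝔸 →L[𝕂] 𝔸 := mulL 𝕂 X - mulR 𝕂 X

variable {𝕂}

/-- `L_X h = X h`. [folklore] -/
@[simp] private theorem mulL_apply (X h : 𝔸) : mulL 𝕂 X h = X * h := rfl

/-- `R_X h = h X`. [folklore] -/
@[simp] private theorem mulR_apply (X h : 𝔸) : mulR 𝕂 X h = h * X := rfl

/-- `ad X (h) = X h − h X`. [cite: Balaban1985Averaging, (29) p.22] -/
@[simp] theorem ad_apply (X h : 𝔸) : ad 𝕂 X h = X * h - h * X := rfl

/-- `ad (−X) = −ad X` (linearity of `X ↦ ad_X`). [cite: Balaban1985Averaging, (29) p.22] -/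
theorem ad_neg (X : 𝔸) : ad 𝕂 (-X) = -ad 𝕂 X := by
  ext h; simp [sub_eq_add_neg, add_comm]

/-- `ad (c X) = c · ad X` (linearity of `X ↦ ad_X`). [cite: Balaban1985Averaging, (29) p.22] -/
theorem ad_smul (c : 𝕂) (X : 𝔸) : ad 𝕂 (c • X) = c • ad 𝕂 X := by
  ext h; simp [smul_sub]

/-- `‖ad X‖ ≤ 2‖X‖` (`‖Xh − hX‖ ≤ 2‖X‖‖h‖`; used to place `±ad_Y`, `±i ad_Y` inside the disc `‖T‖ ≤ 1` where
`g(T)` is inverted, (34)). [cite: Balaban1985Averaging, (29) p.22] -/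
theorem norm_ad_le (X : 𝔸) : ‖ad 𝕂 X‖ ≤ 2 * ‖X‖ := by
  refine ContinuousLinearMap.opNorm_le_bound _ (by positivity) fun h => ?_
  rw [ad_apply]
  calc ‖X * h - h * X‖ ≤ ‖X * h‖ + ‖h * X‖ := norm_sub_le _ _
    _ ≤ ‖X‖ * ‖h‖ + ‖h‖ * ‖X‖ := add_le_add (norm_mul_le _ _) (norm_mul_le _ _)
    _ = 2 * ‖X‖ * ‖h‖ := by ring

/-- Left and right multiplications commute (associativity). [folklore] -/
private theorem commute_mulL_mulR (X Y : 𝔸) : Commute (mulL 𝕂 X) (mulR 𝕂 Y) := by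
  ext h; simp [mul_assoc]

/-- `L_X^n = L_{X^n}`. [folklore] -/
private theorem mulL_pow (X : 𝔸) (n : ℕ) : mulL 𝕂 X ^ n = mulL 𝕂 (X ^ n) := by
  induction n with
  | zero => ext h; simp
  | succ n ih => ext h; rw [pow_succ, mul_apply_eq_comp, ih]; simp [pow_succ, mul_assoc]

/-- `R_X^n = R_{X^n}`. [folklore] -/
private theorem mulR_pow (X : 𝔸) (n : ℕ) : mulR 𝕂 X ^ n = mulR 𝕂 (X ^ n) := by
  induction n with
  | zero => ext h; simp
  | succ n ih => ext h; rw [pow_succ, mul_apply_eq_comp, ih]; simp [pow_succ', mul_assoc]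

/-- The powers `(ad_X)ⁿ` of (32): `(ad X)^{n+1} h = X·((ad X)^n h) − ((ad X)^n h)·X`.
[cite: Balaban1985Averaging, (32) p.22] -/
theorem ad_pow_succ_apply (X h : 𝔸) (n : ℕ) :
    (ad 𝕂 X ^ (n + 1)) h = X * (ad 𝕂 X ^ n) h - (ad 𝕂 X ^ n) h * X := by
  rw [pow_succ', mul_apply_eq_comp, ad_apply]

/-- `symSum L_X R_X N (h) = Σ_{k<N} X^k h X^{N−1−k}` — the derivative of `x ↦ xᴺ` at `X`. [folklore] -/
private theorem symSum_mulL_mulR_apply (X h : 𝔸) (N : ℕ) :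
    symSum (mulL 𝕂 X) (mulR 𝕂 X) N h = ∑ k ∈ range N, X ^ k * h * X ^ (N - 1 - k) := by
  unfold symSum
  rw [FunLike.coe_sum, Finset.sum_apply]
  refine sum_congr rfl fun k _ => ?_
  rw [mulL_pow, mulR_pow, mul_apply_eq_comp, mulR_apply, mulL_apply, mul_assoc]

/-- `‖X^k h‖ ≤ ‖X‖^k ‖h‖` (no `‖1‖ = 1` needed). [folklore] -/
private theorem norm_pow_mul_le (X h : 𝔸) (k : ℕ) : ‖X ^ k * h‖ ≤ ‖X‖ ^ k * ‖h‖ := by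
  induction k with
  | zero => simp
  | succ k ih =>
    rw [pow_succ', mul_assoc, pow_succ', mul_assoc]
    exact (norm_mul_le _ _).trans (mul_le_mul_of_nonneg_left ih (norm_nonneg _))

/-- `‖h X^k‖ ≤ ‖h‖ ‖X‖^k`. [folklore] -/
private theorem norm_mul_pow_le (h X : 𝔸) (k : ℕ) : ‖h * X ^ k‖ ≤ ‖h‖ * ‖X‖ ^ k := by
  induction k with
  | zero => simp
  | succ k ih =>
    rw [pow_succ, ← mul_assoc, pow_succ, ← mul_assoc]
    exact (norm_mul_le _ _).trans (mul_le_mul_of_nonneg_right ih (norm_nonneg _))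

/-- `‖symSum L_X R_X N‖ ≤ N ‖X‖^{N−1}`. [folklore] -/
private theorem norm_symSum_mulL_mulR_le (X : 𝔸) (N : ℕ) :
    ‖symSum (mulL 𝕂 X) (mulR 𝕂 X) N‖ ≤ N * ‖X‖ ^ (N - 1) := by
  refine ContinuousLinearMap.opNorm_le_bound _ (by positivity) fun h => ?_
  rw [symSum_mulL_mulR_apply]
  calc ‖∑ k ∈ range N, X ^ k * h * X ^ (N - 1 - k)‖
      ≤ ∑ k ∈ range N, ‖X ^ k * h * X ^ (N - 1 - k)‖ := norm_sum_le _ _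
    _ ≤ ∑ k ∈ range N, ‖X‖ ^ (N - 1) * ‖h‖ := by
        refine sum_le_sum fun k hk => ?_
        rw [Finset.mem_range] at hk
        calc ‖X ^ k * h * X ^ (N - 1 - k)‖ = ‖X ^ k * (h * X ^ (N - 1 - k))‖ := by rw [mul_assoc]
          _ ≤ ‖X‖ ^ k * ‖h * X ^ (N - 1 - k)‖ := norm_pow_mul_le _ _ _
          _ ≤ ‖X‖ ^ k * (‖h‖ * ‖X‖ ^ (N - 1 - k)) :=
              mul_le_mul_of_nonneg_left (norm_mul_pow_le _ _ _) (by positivity)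
          _ = ‖X‖ ^ (N - 1) * ‖h‖ := by
              rw [mul_left_comm, ← pow_add, show k + (N - 1 - k) = N - 1 by omega, mul_comm]
    _ = N * ‖X‖ ^ (N - 1) * ‖h‖ := by rw [sum_const, card_range, nsmul_eq_mul, mul_assoc]

/-- `x ↦ xᴺ` has Fréchet derivative `h ↦ Σ_{k<N} X^k h X^{N−1−k}` at `X` (Leibniz rule, induction on `N`). [folklore] -/
private theorem hasFDerivAt_pow_symSum (X : 𝔸) (N : ℕ) :
    HasFDerivAt (fun x : 𝔸 => x ^ N) (symSum (mulL 𝕂 X) (mulR 𝕂 X) N) X := by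
  induction N with
  | zero =>
    simp only [pow_zero, symSum, Finset.range_zero, Finset.sum_empty]
    exact hasFDerivAt_const (1 : 𝔸) X
  | succ N ih =>
    have h := ih.mul' (hasFDerivAt_id X)
    have hf : (fun x : 𝔸 => x ^ N) * id = fun x : 𝔸 => x ^ (N + 1) := by
      funext x; simp [pow_succ]
    rw [hf] at h
    refine h.congr_fderiv ?_
    ext v
    simp only [add_apply, smul_apply, ContinuousLinearMap.id_apply,
      smul_eq_mul, op_smul_eq_mul, id_eq, symSum_mulL_mulR_apply]
    rw [Finset.sum_range_succ, Finset.sum_mul, Nat.add_sub_cancel, Nat.sub_self, pow_zero, mul_one,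
      add_comm (X ^ N * v)]
    congr 1
    refine Finset.sum_congr rfl fun k hk => ?_
    rw [Finset.mem_range] at hk
    rw [mul_assoc, ← pow_succ, show N - 1 - k + 1 = N - k by omega]

variable [CompleteSpace 𝔸]

/-- `exp (L_X) = L_{exp X}` in the Banach algebra `𝔸 →L[𝕂] 𝔸`. [folklore] -/
private theorem exp_mulL (X : 𝔸) : exp (mulL 𝕂 X) = mulL 𝕂 (exp X) := by
  have h1 : HasSum (fun n : ℕ => (n !⁻¹ : 𝕂) • mulL 𝕂 X ^ n) (exp (mulL 𝕂 X)) := exp_series_hasSum_exp' _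
  have h2 : HasSum (fun n : ℕ => (n !⁻¹ : 𝕂) • X ^ n) (exp X) := exp_series_hasSum_exp' X
  have h3 := (ContinuousLinearMap.mul 𝕂 𝔸).hasSum h2
  have h4 : (fun n : ℕ => ContinuousLinearMap.mul 𝕂 𝔸 ((n !⁻¹ : 𝕂) • X ^ n)) =
      fun n : ℕ => (n !⁻¹ : 𝕂) • mulL 𝕂 X ^ n := by
    funext n; rw [map_smul, mulL_pow]; rfl
  rw [h4] at h3
  exact h1.unique h3

/-- `exp (R_X) = R_{exp X}`. [folklore] -/
private theorem exp_mulR (X : 𝔸) : exp (mulR 𝕂 X) = mulR 𝕂 (exp X) := by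
  have h1 : HasSum (fun n : ℕ => (n !⁻¹ : 𝕂) • mulR 𝕂 X ^ n) (exp (mulR 𝕂 X)) := exp_series_hasSum_exp' _
  have h2 : HasSum (fun n : ℕ => (n !⁻¹ : 𝕂) • X ^ n) (exp X) := exp_series_hasSum_exp' X
  have h3 := ((ContinuousLinearMap.mul 𝕂 𝔸).flip).hasSum h2
  have h4 : (fun n : ℕ => (ContinuousLinearMap.mul 𝕂 𝔸).flip ((n !⁻¹ : 𝕂) • X ^ n)) =
      fun n : ℕ => (n !⁻¹ : 𝕂) • mulR 𝕂 X ^ n := by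
    funext n; rw [map_smul, mulR_pow]; rfl
  rw [h4] at h3
  exact h1.unique h3

/-- **`Ad(e^X) = e^{ad X}`** (Hall, Proposition 3.35): `exp (ad X) h = e^{X} h e^{−X}` — from `ad X = L_X − R_X` with
`L_X`, `R_X` commuting, `e^{L_X} = L_{e^X}`, `e^{−R_X} = R_{e^{−X}}`. [cite: Hall2015, Prop 3.35] -/
theorem exp_ad_apply (X h : 𝔸) : exp (ad 𝕂 X) h = exp X * h * exp (-X) := by
  have hc : Commute (mulL 𝕂 X) (-mulR 𝕂 X) := (commute_mulL_mulR X X).neg_right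
  have hsplit : exp (ad 𝕂 X) = exp (mulL 𝕂 X) * exp (-mulR 𝕂 X) := by
    rw [ad, sub_eq_add_neg]
    exact exp_add_of_commute_of_mem_ball (𝕂 := 𝕂) hc (by simp [expSeries_radius_eq_top])
      (by simp [expSeries_radius_eq_top])
  have hneg : -mulR 𝕂 X = mulR 𝕂 (-X) := by ext v; simp
  rw [hsplit, hneg, exp_mulL, exp_mulR, mul_apply_eq_comp, mulR_apply, mulL_apply, mul_assoc]


/-! ### §2. The differential of `exp`: Theorem 2.14.3 / Theorem 5.4 / (32) -/

/-- **`D exp_X`** as an element of `𝔸 →L[𝕂] 𝔸`: `dexp X = Σ_N (1/N!) symSum L_X R_X N`, i.e.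
`dexp X (h) = Σ_{N≥1} (1/N!) Σ_{k<N} X^k h X^{N−1−k}` (the term-by-term derivative of `Σ Xᴺ/N!`).
[cite: Hall2015, Thm 5.4] -/
def dexp (𝕂' : Type*) [RCLike 𝕂'] {𝔸' : Type*} [NormedRing 𝔸'] [NormedAlgebra 𝕂' 𝔸'] (X : 𝔸') :
    𝔸' →L[𝕂'] 𝔸' :=
  ∑' N : ℕ, (N !⁻¹ : 𝕂') • symSum (mulL 𝕂' X) (mulR 𝕂' X) N

omit [CompleteSpace 𝔸] in
/-- Evaluating a convergent series of operators: `(Σ_n f n)(h) = Σ_n f n (h)`. [folklore] -/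
private theorem tsum_apply_eq {f : ℕ → 𝔸 →L[𝕂] 𝔸} (hf : Summable f) (h : 𝔸) : (∑' n, f n) h = ∑' n, f n h := by
  have := (ContinuousLinearMap.apply 𝕂 𝔸 h).map_tsum hf
  simpa only [ContinuousLinearMap.apply_apply] using this

/-- `dexp X (h) = Σ_N (1/N!) Σ_{k<N} X^k h X^{N−1−k}`. [cite: Hall2015, Thm 5.4] -/
theorem dexp_apply_eq_tsum (X h : 𝔸) :
    dexp 𝕂 X h = ∑' N : ℕ, (N !⁻¹ : 𝕂) • ∑ k ∈ range N, X ^ k * h * X ^ (N - 1 - k) := by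
  unfold dexp
  rw [tsum_apply_eq (hasSum_inv_factorial_smul_symSum (𝕂 := 𝕂) (commute_mulL_mulR (𝕂 := 𝕂) X X)).summable]
  refine tsum_congr fun N => ?_
  rw [smul_apply, symSum_mulL_mulR_apply]

/-- **`Σ_N (1/N!) symSum L_X R_X N = L_{e^X} · g(ad X)`** — the series defining `dexp X` summed in closed form
(§3 with the commuting pair `L_X`, `R_X`, and `e^{L_X} = L_{e^X}`). [cite: Hall2015, Thm 5.4] -/
theorem hasSum_dexp (X : 𝔸) :
    HasSum (fun N : ℕ => (N !⁻¹ : 𝕂) • symSum (mulL 𝕂 X) (mulR 𝕂 X) N) (mulL 𝕂 (exp X) * gSer 𝕂 (ad 𝕂 X)) := by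
  have h := hasSum_inv_factorial_smul_symSum (𝕂 := 𝕂) (commute_mulL_mulR (𝕂 := 𝕂) X X)
  rwa [exp_mulL] at h

/-- `dexp X = L_{e^X} · g(ad X)` («`D exp_X = e^X (1 − e^{−ad_X})/ad_X`»). [cite: Hall2015, Thm 5.4] -/
theorem dexp_eq (X : 𝔸) : dexp 𝕂 X = mulL 𝕂 (exp X) * gSer 𝕂 (ad 𝕂 X) :=
  (hasSum_dexp X).tsum_eq

/-- `dexp X (h) = e^X · g(ad X)(h)`. [cite: Hall2015, Thm 5.4] -/
theorem dexp_apply (X h : 𝔸) : dexp 𝕂 X h = exp X * gSer 𝕂 (ad 𝕂 X) h := by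
  rw [dexp_eq, mul_apply_eq_comp, mulL_apply]

/-- The summable majorant used for term-by-term differentiation: `Σ_N (1/N!) N ρ^{N−1} < ∞`. [folklore] -/
private theorem summable_majorant (ρ : ℝ) : Summable fun N : ℕ => (N ! : ℝ)⁻¹ * (N * ρ ^ (N - 1)) := by
  refine (summable_nat_add_iff 1).mp ?_
  have h : (fun N : ℕ => ((N + 1)! : ℝ)⁻¹ * ((N + 1 : ℕ) * ρ ^ (N + 1 - 1))) = fun N : ℕ => ρ ^ N / N ! := by
    funext N
    rw [Nat.add_sub_cancel, Nat.factorial_succ, Nat.cast_mul]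
    have hN : ((N + 1 : ℕ) : ℝ) ≠ 0 := by exact_mod_cast Nat.succ_ne_zero N
    have hf : (N ! : ℝ) ≠ 0 := by exact_mod_cast (Nat.factorial_pos N).ne'
    field_simp
  rw [h]
  exact Real.summable_pow_div_factorial ρ

/-- **THE DIFFERENTIAL OF THE EXPONENTIAL MAP** (Varadarajan, Theorem 2.14.3; Hall, Theorem 5.4): in a Banach algebra,
`exp` has Fréchet derivative `dexp X = L_{e^X} g(ad X)` at every `X`, i.e. `D exp_X(h) = e^X Σ_n ((−1)ⁿ/(n+1)!)(ad X)ⁿ h`.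
Proof: term-by-term differentiation of `exp = Σ_N Xᴺ/N!` on the ball `‖x‖ < ‖X‖ + 1`
(`hasFDerivAt_tsum_of_isPreconnected` with the majorant `Σ N ρ^{N−1}/N!`). [cite: Varadarajan1984, Thm 2.14.3] -/
theorem hasFDerivAt_exp_dexp (X : 𝔸) : HasFDerivAt (exp : 𝔸 → 𝔸) (dexp 𝕂 X) X := by
  set ρ : ℝ := ‖X‖ + 1 with hρ
  have hs : IsOpen (Metric.ball (0 : 𝔸) ρ) := Metric.isOpen_ball
  letI : NormedSpace ℝ 𝔸 := NormedSpace.restrictScalars ℝ 𝕂 𝔸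
  have hs' : IsPreconnected (Metric.ball (0 : 𝔸) ρ) := (convex_ball (0 : 𝔸) ρ).isPreconnected
  have hX : X ∈ Metric.ball (0 : 𝔸) ρ := by
    rw [Metric.mem_ball, dist_zero_right, hρ]; exact lt_add_one _
  have hf : ∀ (N : ℕ) (x : 𝔸), x ∈ Metric.ball (0 : 𝔸) ρ →
      HasFDerivAt (fun x : 𝔸 => (N !⁻¹ : 𝕂) • x ^ N) ((N !⁻¹ : 𝕂) • symSum (mulL 𝕂 x) (mulR 𝕂 x) N) x :=
    fun N x _ => (hasFDerivAt_pow_symSum x N).fun_const_smul _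
  have hf' : ∀ (N : ℕ) (x : 𝔸), x ∈ Metric.ball (0 : 𝔸) ρ →
      ‖(N !⁻¹ : 𝕂) • symSum (mulL 𝕂 x) (mulR 𝕂 x) N‖ ≤ (N ! : ℝ)⁻¹ * (N * ρ ^ (N - 1)) := by
    intro N x hx
    rw [Metric.mem_ball, dist_zero_right] at hx
    rw [norm_smul, norm_inv, RCLike.norm_natCast]
    refine mul_le_mul_of_nonneg_left ?_ (by positivity)
    refine (norm_symSum_mulL_mulR_le x N).trans ?_
    exact mul_le_mul_of_nonneg_left (pow_le_pow_left₀ (norm_nonneg _) hx.le _) (Nat.cast_nonneg _)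
  have hf0 : Summable fun N : ℕ => (N !⁻¹ : 𝕂) • X ^ N := expSeries_summable' X
  have key := hasFDerivAt_tsum_of_isPreconnected (summable_majorant ρ) hs hs' hf hf' hX hf0 hX
  rw [exp_eq_tsum 𝕂]
  exact key

/-- `fderiv exp X = dexp X`. [cite: Varadarajan1984, Thm 2.14.3] -/
theorem fderiv_exp_eq_dexp (X : 𝔸) : fderiv 𝕂 (exp : 𝔸 → 𝔸) X = dexp 𝕂 X :=
  (hasFDerivAt_exp_dexp X).fderiv

/-- **Theorem 2.14.3 / Theorem 5.4 (5.10)**: `D exp_X(h) = e^{X} · g(ad X)(h) = e^X Σ_n ((−1)ⁿ/(n+1)!)(ad_X)ⁿ h`.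
[cite: Varadarajan1984, Thm 2.14.3] -/
theorem fderiv_exp_apply (X h : 𝔸) : fderiv 𝕂 (exp : 𝔸 → 𝔸) X h = exp X * gSer 𝕂 (ad 𝕂 X) h := by
  rw [fderiv_exp_eq_dexp, dexp_apply]

/-- The trivialised differential: `e^{−X} · D exp_X(h) = g(ad X)(h)`. [cite: Varadarajan1984, Thm 2.14.3] -/
theorem exp_neg_mul_fderiv_exp_apply (X h : 𝔸) :
    exp (-X) * fderiv 𝕂 (exp : 𝔸 → 𝔸) X h = gSer 𝕂 (ad 𝕂 X) h := by
  rw [fderiv_exp_apply, ← mul_assoc, exp_neg_mul_exp_eq_one (𝕂 := 𝕂), one_mul]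

/-- **(32) along a curve** (Hall (5.11)): if `A` has derivative `A′` at `t` then
`(d/dt) e^{A(t)} = e^{A(t)} · g(ad_{A(t)}) A′`. [cite: Balaban1985Averaging, (32) p.22] -/
theorem hasDerivAt_exp_comp_gSer {A : 𝕂 → 𝔸} {A' : 𝔸} {t : 𝕂} (hA : HasDerivAt A A' t) :
    HasDerivAt (fun t => exp (A t)) (exp (A t) * gSer 𝕂 (ad 𝕂 (A t)) A') t := by
  have h := (hasFDerivAt_exp_dexp (𝕂 := 𝕂) (A t)).comp_hasDerivAt t hA
  rw [dexp_apply] at h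
  exact h

/-- **(32) as printed**: «`e^{−A(t)} (d/dt) e^{A(t)} = Σ_{n=0}^∞ ((−1)ⁿ/(n+1)!) (ad_{A(t)})ⁿ A′(t) = g(ad_{A(t)}) A′(t)`,
where `A(t)` is a differentiable matrix-valued function of `t`» — here for a curve in any Banach algebra.
[cite: Balaban1985Averaging, (32) p.22] -/
theorem exp_neg_mul_deriv_exp_comp {A : 𝕂 → 𝔸} {A' : 𝔸} {t : 𝕂} (hA : HasDerivAt A A' t) :
    exp (-A t) * deriv (fun t => exp (A t)) t = gSer 𝕂 (ad 𝕂 (A t)) A' := by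
  rw [(hasDerivAt_exp_comp_gSer hA).deriv, ← mul_assoc, exp_neg_mul_exp_eq_one (𝕂 := 𝕂), one_mul]

/-- (32), the middle member spelled out as the printed series: `e^{−A(t)}(e^{A})′(t) = Σ_n ((−1)ⁿ/(n+1)!) (ad_{A(t)})ⁿ A′`.
[cite: Balaban1985Averaging, (32) p.22] -/
theorem exp_neg_mul_deriv_exp_comp_eq_tsum {A : 𝕂 → 𝔸} {A' : 𝔸} {t : 𝕂} (hA : HasDerivAt A A' t) :
    exp (-A t) * deriv (fun t => exp (A t)) t =
      ∑' n : ℕ, ((-1) ^ n * ((n + 1)! : 𝕂)⁻¹) • (ad 𝕂 (A t) ^ n) A' := by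
  rw [exp_neg_mul_deriv_exp_comp hA, gSer_eq_tsum_neg_one_pow,
    tsum_apply_eq (summable_gSer_term' (𝕂 := 𝕂) (ad 𝕂 (A t)))]
  simp only [smul_apply]

/-- `g(T)(h)` spelled out for an operator `T` (print: «We will treat the expression `ad_X Y` for a fixed `X` as a
linear operator on a space of matrices `Y`. For an entire function `f(z) = Σ_n fₙ zⁿ` we define
`f(ad_X) Y = Σ_{n=0}^∞ fₙ (ad_X)ⁿ Y`», p. 22): `g(T) h = Σ_n ((−1)ⁿ/(n+1)!) Tⁿ h`.
[cite: Balaban1985Averaging, (32)–(33) p.22] -/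
theorem gSer_apply_eq_tsum (T : 𝔸 →L[𝕂] 𝔸) (h : 𝔸) :
    gSer 𝕂 T h = ∑' n : ℕ, ((-1) ^ n * ((n + 1)! : 𝕂)⁻¹) • (T ^ n) h := by
  rw [gSer_eq_tsum_neg_one_pow, tsum_apply_eq (summable_gSer_term' (𝕂 := 𝕂) T)]
  simp only [smul_apply]

/-- `g(ad X)(h)` spelled out: `= Σ_n ((−1)ⁿ/(n+1)!) (ad X)ⁿ h`. [cite: Balaban1985Averaging, (32)–(33) p.22] -/
theorem gSer_ad_apply (X h : 𝔸) :
    gSer 𝕂 (ad 𝕂 X) h = ∑' n : ℕ, ((-1) ^ n * ((n + 1)! : 𝕂)⁻¹) • (ad 𝕂 X ^ n) h :=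
  gSer_apply_eq_tsum (ad 𝕂 X) h

/-- `e^{ad X} g(ad X) = g(−ad X) = g(ad (−X))` (the identity used to pass from `D exp_Y(D) = X e^Y` to
`D = g⁻¹(−ad_Y) X`, [Balaban1985Averaging] (36)–(37)). [cite: Balaban1985Averaging, (33)–(34) p.22–23] -/
theorem exp_ad_mul_gSer_ad (X : 𝔸) : exp (ad 𝕂 X) * gSer 𝕂 (ad 𝕂 X) = gSer 𝕂 (ad 𝕂 (-X)) := by
  rw [exp_mul_gSer, ad_neg]

end Algebra

end Literature.Analysis.Calculus.ExpDifferential
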